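import Mathlib.Tactic.FieldSimp
import Summits.Ventures.CertifiedArithmetic.LowPrec.SRLimitedBits
import Summits.Ventures.CertifiedArithmetic.LowPrec.SRCertificatesFP4
import Summits.Ventures.CertifiedArithmetic.LowPrec.SRCertificatesFP6FP8
import HarnessLib

/-! # Limited-randomness SR, III: the half-bit rules are minimax optimal, and stagnation returns

HONEST FRAMING: certified error envelopes and provably optimal rounding/accumulation schemes for
low-precision formats under stated cost models; every table by two implementations; no hardware or
vendor claims.

Venture CertifiedArithmetic / lowprec, SR slice (file XXVII). Two exact statements about stochastic
rounding driven by `N` uniformly random bits (files I/II: `SRLimitedBitsCounts`, `SRLimitedBits`;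
P3109 `StochasticA/B/C` = `probAwayA/B/C`).

* **Minimax (A).** Every rule "round away iff `mode N R η`" with `R` uniform on `{0,…,2^N−1}` has an
  away-probability in `2^{-N}ℤ`, hence misses the exact-SR probability `η` by AT LEAST `2^{-(N+1)}`
  at every odd multiple of `2^{-(N+1)}` (`abs_dyadic_sub_odd_ge`, `awayProb_minimax`): the constant
  `2^{-(N+1)}` of StochasticB/C (file I) is optimal among all `N`-bit rules, and the per-step bias
  `gap/2^{N+1}` is forced at the input `a + gap/2^{N+1}` of every gap `[a, b]` of every finite
  format (`stepQ_minimax`); StochasticA misses by `3·2^{-(N+2)} > 2^{-(N+1)}`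
  (`stochasticA_not_minimax`).
* **Stagnation (B).** If the perturbed up-probability vanishes at `a + δ` inside a gap `[a, b]`, the
  recursive accumulation of the constant `δ` from `a` never moves: `E f(ŝₙ) = f(a)` for every `n`
  (`accExpQ_const_stagnates`, `stagnation_of_gap`), bias exactly `−nδ`. Thresholds: StochasticC
  stagnates for `δ ≤ gap/2^{N+1}` (the tie INCLUDED, by ties-to-even: `probAwayC_eq_zero`),
  StochasticB for `δ < gap/2^{N+1}` (at the tie it rounds up with probability `2^{-N}`, twice the
  exact one: `probAwayB_half`), StochasticA for `δ < gap/2^N`; so the n-step bias bound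
  `n·G·2^{-(N+1)}` of file II is ATTAINED by StochasticC (`stochasticC_bias_bound_attained`),
  whereas exact SR never stagnates (`accExp_id_of_noSat`, file II of the SR slice). `N` random bits
  interpolate between round-to-nearest (`N = 0`: stagnation below half a gap,
  [ConnollyHighamMary2021] §1) and exact SR (`N = ∞`). Kernel instances (FP4/FP6 literals, every
  `n`): the E3M2 ones-counter with ONE random bit under StochasticC is absorbed at `16` (gap `4`;
  the increment `1` is `4/2^2`) and never reaches `28`; with `N = 0` the E2M1 ones-counter is
  absorbed at `4` (RN stagnation) while exact SR reaches `6` (file XXIV). Literature: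
  limited-precision SR `SR_{p,r}` has bias `tr_{p+r}(x) − x` [ElararEtAl2025, §3] (= the StochasticA
  dictionary); loss of increments once "the probability of rounding up becomes 0" with limited
  random bits is observed in [Mikaitis2021] (harmonic sum); input-averaged bias of SRFF/SRF/SRC
  [FitzgibbonFelix2025]. The pointwise minimax constant, the exact thresholds and the attainment are
  new here as kernel-checked statements; no claim about any implementation. -/

namespace Summit.Ventures.CertifiedArithmetic.LowPrec.SR.LimitedBits

open Literature.ComputerArithmetic.P3109
open Literature.ComputerArithmetic.ConnollyHighamMary2021
open Summit.Ventures.CertifiedArithmetic.LowPrec.SR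
open Finset

variable {K : Type*} [Field K] [LinearOrder K] [IsStrictOrderedRing K] [FloorRing K]

/-! ### A. No `N`-bit rule beats `2^{-(N+1)}` -/

omit [FloorRing K] in
/-- **The dyadic miss**: a point of `2^{-N}ℤ` is at distance `≥ 2^{-(N+1)}` from every odd multiple
of `2^{-(N+1)}` (the numerator `2m − (2j+1)` is an odd, hence nonzero, integer). -/
theorem abs_dyadic_sub_odd_ge (N : ℕ) (m j : ℤ) :
    (1 : K) / 2 ^ (N + 1) ≤ |(m : K) / 2 ^ N - (2 * j + 1) / 2 ^ (N + 1)| := by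
  have h2 : (0 : K) < 2 ^ (N + 1) := by positivity
  have hz : (2 * m - (2 * j + 1) : ℤ) ≠ 0 := by omega
  have h1 : (1 : ℤ) ≤ |2 * m - (2 * j + 1)| := Int.one_le_abs hz
  have hK : (1 : K) ≤ |((2 * m - (2 * j + 1) : ℤ) : K)| := by exact_mod_cast h1
  rw [show (m : K) / 2 ^ N - (2 * j + 1) / 2 ^ (N + 1)
      = ((2 * m - (2 * j + 1) : ℤ) : K) / 2 ^ (N + 1) by push_cast; field_simp; ring]
  rw [abs_div, abs_of_pos h2, le_div_iff₀ h2, div_mul_cancel₀ _ h2.ne']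
  exact hK

omit [FloorRing K] in
/-- **Minimax lower bound for every `N`-bit rounding rule.** For ANY decision predicate `mode N R η`
(round away iff it holds; `R` uniform on `{0,…,2^N−1}`, so `P(away) = awayCount/2^N`), at every
input fraction `η = (2j+1)/2^{N+1}` the away-probability misses the exact-SR value `η` by at least
`2^{-(N+1)}`. StochasticB and StochasticC achieve `≤ 2^{-(N+1)}` everywhere (file I), so they are
minimax optimal among all `N`-bit rules. -/
theorem awayProb_minimax (mode : ℕ → ℕ → K → Prop) [∀ N R η, Decidable (mode N R η)] (N : ℕ)
    (j : ℤ) :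
    (1 : K) / 2 ^ (N + 1) ≤ |(awayCount mode N (((2 * j + 1 : ℤ) : K) / 2 ^ (N + 1)) : K) / 2 ^ N
      - ((2 * j + 1 : ℤ) : K) / 2 ^ (N + 1)| := by
  have h :=
    abs_dyadic_sub_odd_ge (K := K) N (awayCount mode N (((2 * j + 1 : ℤ) : K) / 2 ^ (N + 1))) j
  push_cast at h ⊢
  exact h

omit [FloorRing K] in
/-- The headline instance `η = 2^{-(N+1)}`: every `N`-bit rule misses by `≥ 2^{-(N+1)}` there; in
particular NO rule with finitely many random bits is unbiased on all inputs. -/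
theorem awayProb_minimax_half (mode : ℕ → ℕ → K → Prop) [∀ N R η, Decidable (mode N R η)]
    (N : ℕ) :
    (1 : K) / 2 ^ (N + 1)
      ≤ |(awayCount mode N ((1 : K) / 2 ^ (N + 1)) : K) / 2 ^ N - 1 / 2 ^ (N + 1)| := by
  have h := awayProb_minimax (K := K) mode N 0
  push_cast at h
  simpa using h

/-- The optimal rules B and C meet the bound: `|P_B(away) − η| ≤ 2^{-(N+1)}`, `|P_C(away) − η| ≤
2^{-(N+1)}` for all `η` (file I), and no `N`-bit rule does better at `η = 2^{-(N+1)}`. -/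
theorem halfBit_rules_minimax_optimal (mode : ℕ → ℕ → K → Prop) [∀ N R η, Decidable (mode N R η)]
    (N : ℕ) :
    (∀ η : K, |probAwayB N η - η| ≤ 1 / 2 ^ (N + 1)) ∧
    (∀ η : K, |probAwayC N η - η| ≤ 1 / 2 ^ (N + 1)) ∧
    (1 : K) / 2 ^ (N + 1)
      ≤ |(awayCount mode N ((1 : K) / 2 ^ (N + 1)) : K) / 2 ^ N - 1 / 2 ^ (N + 1)| :=
  ⟨abs_probAwayB_sub_le N, abs_probAwayC_sub_le N, awayProb_minimax_half mode N⟩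

/-- StochasticA at `η = 1 − 2^{-(N+2)}`: `P_A(away) = 1 − 2^{-N}`. -/
theorem probAwayA_witness (N : ℕ) :
    probAwayA N (1 - (1 : K) / 2 ^ (N + 2)) = 1 - 1 / 2 ^ N := by
  unfold probAwayA
  have h2 : (0 : K) < 2 ^ N := by positivity
  have harg : (1 - (1 : K) / 2 ^ (N + 2)) * 2 ^ N = (((2 : ℤ) ^ N - 1 : ℤ) : K) + 3 / 4 := by
    push_cast; field_simp; ring
  have hfl : ⌊(1 - (1 : K) / 2 ^ (N + 2)) * 2 ^ N⌋ = (2 : ℤ) ^ N - 1 := by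
    rw [harg, Int.floor_intCast_add]
    have : ⌊(3 : K) / 4⌋ = 0 := by
      rw [Int.floor_eq_iff]; constructor <;> norm_num
    rw [this, add_zero]
  rw [hfl]; push_cast; field_simp

/-- **StochasticA is not minimax optimal**: at `η = 1 − 2^{-(N+2)}` it misses by `3·2^{-(N+2)}`,
strictly more than the optimal `2^{-(N+1)}` (its worst case tends to `2^{-N}`, file I). -/
theorem stochasticA_not_minimax (N : ℕ) :
    (1 : K) / 2 ^ (N + 1)
      < |probAwayA N (1 - (1 : K) / 2 ^ (N + 2)) - (1 - (1 : K) / 2 ^ (N + 2))| := by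
  rw [probAwayA_witness]
  have h2 : (0 : K) < 2 ^ (N + 1) := by positivity
  rw [show (1 : K) - 1 / 2 ^ N - (1 - 1 / 2 ^ (N + 2)) = -(3 / 2 ^ (N + 2)) by ring, abs_neg,
    abs_of_pos (by positivity), div_lt_div_iff₀ h2 (by positivity), pow_succ (2 : K) (N + 1)]
  nlinarith

/-! ### Candidates of a point inside a gap of `F` -/

omit [Field K] [IsStrictOrderedRing K] [FloorRing K] in
/-- In a gap `[a, b]` of `F` (consecutive members), a point `a ≤ x < b` rounds down to `a`. -/
theorem roundDown_eq_of_gap {F : Finset K} {a b x : K} (ha : a ∈ F)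
    (hgap : ∀ y ∈ F, y ≤ a ∨ b ≤ y) (hax : a ≤ x) (hxb : x < b) : roundDown F x = a := by
  refine le_antisymm ?_ (le_roundDown_of_mem ha hax)
  have hmem := roundDown_mem (F := F) ⟨a, ha, hax⟩
  rcases hgap _ hmem with h | h
  · exact h
  · exact absurd ((h.trans (roundDown_le F x)).trans_lt hxb) (lt_irrefl _)

omit [Field K] [IsStrictOrderedRing K] [FloorRing K] in
/-- In a gap `[a, b]` of `F`, a point `a < x ≤ b` rounds up to `b`. -/
theorem roundUp_eq_of_gap {F : Finset K} {a b x : K} (hb : b ∈ F)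
    (hgap : ∀ y ∈ F, y ≤ a ∨ b ≤ y) (hax : a < x) (hxb : x ≤ b) : roundUp F x = b := by
  refine le_antisymm (roundUp_le_of_mem hb hxb) ?_
  have hmem := roundUp_mem (F := F) ⟨b, hb, hxb⟩
  rcases hgap _ hmem with h | h
  · exact absurd ((hax.trans_le (le_roundUp F x)).trans_le h) (lt_irrefl _)
  · exact h

omit [IsStrictOrderedRing K] [FloorRing K] in
/-- Candidates and exact up-probability of a point strictly inside a gap: `dn = a`, `up = b`,
`pUp = (x − a)/(b − a)`, and no clamping. -/
theorem candidates_of_gap {F : Finset K} {a b x : K} (ha : a ∈ F) (hb : b ∈ F)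
    (hgap : ∀ y ∈ F, y ≤ a ∨ b ≤ y) (hax : a < x) (hxb : x < b) :
    clamp F x = x ∧ dn F x = a ∧ up F x = b ∧ pUp F x = (x - a) / (b - a) := by
  have hcl : clamp F x = x := clamp_eq_self ⟨⟨a, ha, hax.le⟩, ⟨b, hb, hxb.le⟩⟩
  have hd : roundDown F x = a := roundDown_eq_of_gap ha hgap hax.le hxb
  have hu : roundUp F x = b := roundUp_eq_of_gap hb hgap hax hxb.le
  refine ⟨hcl, ?_, ?_, ?_⟩
  · unfold dn; rw [hcl, hd]
  · unfold up; rw [hcl, hu]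
  · unfold pUp probUp; rw [hcl, hd, hu]

omit [FloorRing K] in
/-- **Per-step minimax in every format.** For every rule `q` whose values on `[0,1]` lie in
`2^{-N}ℤ` (any `N`-bit rule) and every gap `[a, b]` of `F` on the nonnegative side, the input `c = a
+ (b − a)/2^{N+1}` has bias `|E[result] − c| ≥ (b − a)/2^{N+1}` — the value StochasticB/C guarantee
as an upper bound at EVERY input (`abs_stepQ_id_sub_le` with `ε = 2^{-(N+1)}`). -/
theorem stepQ_minimax (F : Finset K) {q : K → K} (N : ℕ) (hq : ∀ η, ∃ m : ℤ, q η = (m : K) / 2 ^ N)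
    {a b : K} (ha : a ∈ F) (hb : b ∈ F) (hab : a < b) (hgap : ∀ y ∈ F, y ≤ a ∨ b ≤ y)
    (ha0 : 0 ≤ a) :
    (b - a) / 2 ^ (N + 1)
      ≤ |stepQ F q (a + (b - a) / 2 ^ (N + 1)) (fun t => t) - (a + (b - a) / 2 ^ (N + 1))| := by
  set c := a + (b - a) / 2 ^ (N + 1) with hc
  have hba : 0 < b - a := sub_pos.mpr hab
  have h2 : (0 : K) < 2 ^ (N + 1) := by positivity
  have h21 : (1 : K) < 2 ^ (N + 1) := one_lt_pow₀ (by norm_num) (by omega)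
  have hac : a < c := by rw [hc]; linarith [div_pos hba h2]
  have hcb : c < b := by
    rw [hc, ← sub_pos]
    have : (b - a) / 2 ^ (N + 1) < b - a := div_lt_self hba h21
    linarith
  obtain ⟨hcl, hd, hu, hp⟩ := candidates_of_gap ha hb hgap hac hcb
  have hη : pUp F c = 1 / 2 ^ (N + 1) := by
    rw [hp, hc]; field_simp; ring
  have hbias := stepQ_id_sub F q c
  rw [hcl] at hbias
  rw [hbias, hu, hd, abs_mul, abs_of_pos hba]
  have hpq : pUpQ F q c = q (1 / 2 ^ (N + 1)) := by
    unfold pUpQ; rw [hd, if_pos ha0, hη]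
  obtain ⟨m, hm⟩ := hq (1 / 2 ^ (N + 1))
  rw [hpq, hη, hm]
  have key := abs_dyadic_sub_odd_ge (K := K) N m 0
  push_cast at key
  simp only [mul_zero, zero_add] at key
  calc (b - a) / 2 ^ (N + 1) = 1 / 2 ^ (N + 1) * (b - a) := by ring
    _ ≤ |(m : K) / 2 ^ N - 1 / 2 ^ (N + 1)| * (b - a) := mul_le_mul_of_nonneg_right key hba.le

omit [IsStrictOrderedRing K] in
/-- The three P3109 rules take values in `2^{-N}ℤ` (so `stepQ_minimax` applies to each). -/
theorem probAway_dyadic (N : ℕ) (η : K) :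
    (∃ m : ℤ, probAwayA N η = (m : K) / 2 ^ N) ∧ (∃ m : ℤ, probAwayB N η = (m : K) / 2 ^ N) ∧
    (∃ m : ℤ, probAwayC N η = (m : K) / 2 ^ N) :=
  ⟨⟨_, rfl⟩, ⟨_, rfl⟩, ⟨_, rfl⟩⟩

/-! ### B. Stagnation returns under limited randomness -/

omit [IsStrictOrderedRing K] [FloorRing K] in
/-- **Stagnation core.** If the step from `s` with increment `δ` rounds down to `s` with probability
one (`dn = s`, perturbed up-probability `0`), then accumulating the constant `δ` from `s` never
moves: `E f(ŝₙ) = f(s)` for every `n` and every `f`. -/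
theorem accExpQ_const_stagnates (F : Finset K) (q : K → K) {s δ : K} (hdn : dn F (s + δ) = s)
    (hp : pUpQ F q (s + δ) = 0) (f : K → K) :
    ∀ n : ℕ, accExpQ F q (fun _ => δ) n f s = f s
  | 0 => rfl
  | n + 1 => by
    show stepQ F q (s + δ) (accExpQ F q (fun _ => δ) n f) = f s
    unfold stepQ
    rw [hp, hdn, accExpQ_const_stagnates F q hdn hp f n]
    ring

omit [FloorRing K] in
/-- **Stagnation in a gap.** `[a, b]` a gap of `F` with `0 ≤ a`, `0 < δ < b − a`, and a rule `q`
with `q(δ/(b − a)) = 0`: the accumulation of the constant `δ` from `a` is absorbed at `a` — mean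
`a`, bias exactly `−nδ`, for every `n`. -/
theorem stagnation_of_gap (F : Finset K) {q : K → K} {a b δ : K} (ha : a ∈ F) (hb : b ∈ F)
    (hgap : ∀ y ∈ F, y ≤ a ∨ b ≤ y) (ha0 : 0 ≤ a) (hδ0 : 0 < δ) (hδ : δ < b - a)
    (hq : q (δ / (b - a)) = 0) (f : K → K) (n : ℕ) :
    accExpQ F q (fun _ => δ) n f a = f a := by
  have hac : a < a + δ := by linarith
  have hcb : a + δ < b := by linarith
  obtain ⟨-, hd, -, hp⟩ := candidates_of_gap ha hb hgap hac hcb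
  refine accExpQ_const_stagnates F q hd ?_ f n
  unfold pUpQ
  rw [hd, if_pos ha0, hp, show a + δ - a = δ by ring, hq]

omit [FloorRing K] in
/-- ... so the bias after `n` additions is exactly `−nδ`. -/
theorem stagnation_bias_of_gap (F : Finset K) {q : K → K} {a b δ : K} (ha : a ∈ F) (hb : b ∈ F)
    (hgap : ∀ y ∈ F, y ≤ a ∨ b ≤ y) (ha0 : 0 ≤ a) (hδ0 : 0 < δ) (hδ : δ < b - a)
    (hq : q (δ / (b - a)) = 0) (n : ℕ) :
    accExpQ F q (fun _ => δ) n (fun t => t) a - (a + ∑ _i ∈ range n, δ) = -(n * δ) := by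
  rw [stagnation_of_gap F ha hb hgap ha0 hδ0 hδ hq, sum_const, card_range, nsmul_eq_mul]
  ring

/-! ### Thresholds of the three P3109 rules -/

/-- StochasticC never rounds away for `0 ≤ η ≤ 2^{-(N+1)}` — the tie `η = 2^{-(N+1)}` INCLUDED
(`RNITE(1/2) = 0`, ties to even). -/
theorem probAwayC_eq_zero (N : ℕ) {η : K} (h0 : 0 ≤ η) (h : η ≤ 1 / 2 ^ (N + 1)) :
    probAwayC N η = 0 := by
  unfold probAwayC
  have h2 : (0 : K) < 2 ^ N := by positivity
  have hX0 : 0 ≤ η * 2 ^ N := by positivity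
  have hX : η * 2 ^ N ≤ 1 / 2 := by
    have := mul_le_mul_of_nonneg_right h h2.le
    rwa [show (1 : K) / 2 ^ (N + 1) * 2 ^ N = 1 / 2 by rw [pow_succ]; field_simp] at this
  have hfl : ⌊η * 2 ^ N⌋ = 0 := by
    rw [Int.floor_eq_iff]; push_cast; constructor <;> linarith
  have hr : rnite (η * 2 ^ N) = 0 := by
    unfold rnite; rw [hfl]; push_cast
    split_ifs with h1 h2' h3
    · rfl
    · linarith
    · exact absurd h3 (by decide)
    · simp
  rw [hr]; simp

/-- StochasticB never rounds away for `0 ≤ η < 2^{-(N+1)}` ... -/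
theorem probAwayB_eq_zero (N : ℕ) {η : K} (h0 : 0 ≤ η) (h : η < 1 / 2 ^ (N + 1)) :
    probAwayB N η = 0 := by
  unfold probAwayB
  have h2 : (0 : K) < 2 ^ N := by positivity
  have hX0 : 0 ≤ η * 2 ^ N := by positivity
  have hX : η * 2 ^ N < 1 / 2 := by
    have := mul_lt_mul_of_pos_right h h2
    rwa [show (1 : K) / 2 ^ (N + 1) * 2 ^ N = 1 / 2 by rw [pow_succ]; field_simp] at this
  have hfl : ⌊η * 2 ^ N + 1 / 2⌋ = 0 := by
    rw [Int.floor_eq_iff]; push_cast; constructor <;> linarith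
  rw [hfl]; simp

/-- ... but AT the tie it rounds away with probability `2^{-N}`, twice the exact-SR value (so B is
biased upward there by `+gap/2^{N+1}`, C downward by `−gap/2^{N+1}`: both signs of the minimax
miss). -/
theorem probAwayB_half (N : ℕ) : probAwayB N ((1 : K) / 2 ^ (N + 1)) = 1 / 2 ^ N := by
  unfold probAwayB
  rw [show (1 : K) / 2 ^ (N + 1) * 2 ^ N + 1 / 2 = 1 by rw [pow_succ]; field_simp; ring]
  simp

/-- StochasticA never rounds away for `0 ≤ η < 2^{-N}` (truncation). -/
theorem probAwayA_eq_zero (N : ℕ) {η : K} (h0 : 0 ≤ η) (h : η < 1 / 2 ^ N) :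
    probAwayA N η = 0 := by
  unfold probAwayA
  have h2 : (0 : K) < 2 ^ N := by positivity
  have hX0 : 0 ≤ η * 2 ^ N := by positivity
  have hX : η * 2 ^ N < 1 := by
    have := mul_lt_mul_of_pos_right h h2
    rwa [div_mul_cancel₀ _ h2.ne'] at this
  have hfl : ⌊η * 2 ^ N⌋ = 0 := by
    rw [Int.floor_eq_iff]; push_cast; constructor <;> linarith
  rw [hfl]; simp

/-- **StochasticC stagnation threshold**: in a gap `[a, b]` (`0 ≤ a`), every increment
`0 < δ ≤ (b − a)/2^{N+1}` is absorbed forever — the tie included. -/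
theorem stochasticC_stagnation (F : Finset K) (N : ℕ) {a b δ : K} (ha : a ∈ F) (hb : b ∈ F)
    (hgap : ∀ y ∈ F, y ≤ a ∨ b ≤ y) (ha0 : 0 ≤ a) (hab : a < b) (hδ0 : 0 < δ)
    (hδ : δ ≤ (b - a) / 2 ^ (N + 1)) (f : K → K) (n : ℕ) :
    accExpQ F (probAwayC N) (fun _ => δ) n f a = f a := by
  have hba : 0 < b - a := sub_pos.mpr hab
  have h21 : (1 : K) < 2 ^ (N + 1) := one_lt_pow₀ (by norm_num) (by omega)
  have hδ' : δ < b - a := lt_of_le_of_lt hδ (div_lt_self hba h21)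
  refine stagnation_of_gap F ha hb hgap ha0 hδ0 hδ' ?_ f n
  exact probAwayC_eq_zero N (div_nonneg hδ0.le hba.le)
    ((div_le_iff₀ hba).mpr (by rwa [div_mul_eq_mul_div, one_mul]))

/-- **StochasticB stagnation threshold**: increments `0 < δ < (b − a)/2^{N+1}` are absorbed (at the
tie B moves, `probAwayB_half`). -/
theorem stochasticB_stagnation (F : Finset K) (N : ℕ) {a b δ : K} (ha : a ∈ F) (hb : b ∈ F)
    (hgap : ∀ y ∈ F, y ≤ a ∨ b ≤ y) (ha0 : 0 ≤ a) (hab : a < b) (hδ0 : 0 < δ)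
    (hδ : δ < (b - a) / 2 ^ (N + 1)) (f : K → K) (n : ℕ) :
    accExpQ F (probAwayB N) (fun _ => δ) n f a = f a := by
  have hba : 0 < b - a := sub_pos.mpr hab
  have h21 : (1 : K) < 2 ^ (N + 1) := one_lt_pow₀ (by norm_num) (by omega)
  have hδ' : δ < b - a := hδ.trans (div_lt_self hba h21)
  refine stagnation_of_gap F ha hb hgap ha0 hδ0 hδ' ?_ f n
  exact probAwayB_eq_zero N (div_nonneg hδ0.le hba.le)
    ((div_lt_iff₀ hba).mpr (by rwa [div_mul_eq_mul_div, one_mul]))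

/-- **StochasticA stagnation threshold**: increments `0 < δ < (b − a)/2^N` are absorbed (twice the
window of B/C: truncation drops everything below the last random bit). -/
theorem stochasticA_stagnation (F : Finset K) (N : ℕ) {a b δ : K} (ha : a ∈ F) (hb : b ∈ F)
    (hgap : ∀ y ∈ F, y ≤ a ∨ b ≤ y) (ha0 : 0 ≤ a) (hab : a < b) (hδ0 : 0 < δ)
    (hδ : δ < (b - a) / 2 ^ N) (f : K → K) (n : ℕ) :
    accExpQ F (probAwayA N) (fun _ => δ) n f a = f a := by
  have hba : 0 < b - a := sub_pos.mpr hab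
  have h21 : (1 : K) ≤ 2 ^ N := one_le_pow₀ (by norm_num)
  have hδ' : δ < b - a := hδ.trans_le (div_le_self hba.le h21)
  refine stagnation_of_gap F ha hb hgap ha0 hδ0 hδ' ?_ f n
  exact probAwayA_eq_zero N (div_nonneg hδ0.le hba.le)
    ((div_lt_iff₀ hba).mpr (by rwa [div_mul_eq_mul_div, one_mul]))

/-- **The n-step bias bound of file II is attained.** With `G = b − a` and the increment `δ =
G/2^{N+1}` repeated `n` times from `a`, StochasticC has bias EXACTLY `−n·(2^{-(N+1)}·G)`: the upper
bound `n·(2^{-(N+1)}·G)` of `stochasticC_bias_le` holds with equality, for every `n` and `N`. -/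
theorem stochasticC_bias_bound_attained (F : Finset K) (N : ℕ) {a b : K} (ha : a ∈ F) (hb : b ∈ F)
    (hgap : ∀ y ∈ F, y ≤ a ∨ b ≤ y) (ha0 : 0 ≤ a) (hab : a < b) (n : ℕ) :
    accExpQ F (probAwayC N) (fun _ => (b - a) / 2 ^ (N + 1)) n (fun t => t) a
        - (a + ∑ _i ∈ range n, (b - a) / 2 ^ (N + 1))
      = -(n * (1 / 2 ^ (N + 1) * (b - a))) := by
  have hδ0 : 0 < (b - a) / 2 ^ (N + 1) := div_pos (sub_pos.mpr hab) (by positivity)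
  rw [stochasticC_stagnation F N ha hb hgap ha0 hab hδ0 le_rfl, sum_const, card_range, nsmul_eq_mul]
  ring

/-! ### Kernel instances (FP4 / FP6 literals; every `n`) -/

/-- FP6 E3M2, ONE random bit, StochasticC: the ones-counter started at `16` (gap `[16, 20]`,
`1 = 4/2^2` is the tie) is absorbed at `16` for EVERY number of further additions — it never reaches
the format maximum `28` (exact SR: mean `16 + n` until saturation, file XXIV). -/
theorem e3m2_ones_oneBit_stochasticC_absorbed (n : ℕ) (f : ℚ → ℚ) :
    accExpQ Formats.e3m2 (probAwayC 1) (fun _ => (1 : ℚ)) n f 16 = f 16 := by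
  have h := stochasticC_stagnation (K := ℚ) Formats.e3m2 1 (a := 16) (b := 20) (δ := 1)
    (by decide +kernel) (by decide +kernel) (by decide +kernel) (by norm_num) (by norm_num)
    (by norm_num) (by norm_num) f n
  exact h

/-- Same chain, ONE random bit, StochasticA: also absorbed at `16` (`1 < 4/2`). -/
theorem e3m2_ones_oneBit_stochasticA_absorbed (n : ℕ) (f : ℚ → ℚ) :
    accExpQ Formats.e3m2 (probAwayA 1) (fun _ => (1 : ℚ)) n f 16 = f 16 :=
  stochasticA_stagnation (K := ℚ) Formats.e3m2 1 (a := 16) (b := 20) (δ := 1)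
    (by decide +kernel) (by decide +kernel) (by decide +kernel) (by norm_num) (by norm_num)
    (by norm_num) (by norm_num) f n

/-- ... whereas StochasticB with one bit MOVES at the tie: after one addition from `16` the mean is
`18 = 16 + 2` (over-counting by `+1`: up-probability `1/2` instead of the exact `1/4`). -/
theorem e3m2_ones_oneBit_stochasticB_moves :
    accExpQ Formats.e3m2 (probAwayB 1) (fun _ => (1 : ℚ)) 1 (fun t => t) 16 = 18 := by
  decide +kernel

/-- With TWO random bits none of the three rules stagnates at `16` (the exact probability `1/4` is a
2-bit dyadic): one addition gives the exact-SR mean `17` under A, B and C. -/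
theorem e3m2_ones_twoBit_exact_step :
    accExpQ Formats.e3m2 (probAwayA 2) (fun _ => (1 : ℚ)) 1 (fun t => t) 16 = 17 ∧
    accExpQ Formats.e3m2 (probAwayB 2) (fun _ => (1 : ℚ)) 1 (fun t => t) 16 = 17 ∧
    accExpQ Formats.e3m2 (probAwayC 2) (fun _ => (1 : ℚ)) 1 (fun t => t) 16 = 17 := by
  decide +kernel

/-- FP4 E2M1, NO random bits (`N = 0`: StochasticC degenerates to a deterministic nearest-type
rule): the ones-counter is absorbed at `4` (gap `[4, 6]`, `1 = 2/2`) — round-to-nearest stagnation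
([ConnollyHighamMary2021] §1) as the `N = 0` end of the scale; exact SR reaches `6` (file XXIV). -/
theorem e2m1_ones_zeroBit_absorbed (n : ℕ) (f : ℚ → ℚ) :
    accExpQ FP4.e2m1 (probAwayC 0) (fun _ => (1 : ℚ)) n f 4 = f 4 :=
  stochasticC_stagnation (K := ℚ) FP4.e2m1 0 (a := 4) (b := 6) (δ := 1)
    (by decide +kernel) (by decide +kernel) (by decide +kernel) (by norm_num) (by norm_num)
    (by norm_num) (by norm_num) f n


end Summit.Ventures.CertifiedArithmetic.LowPrec.SR.LimitedBits
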